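import Literature.MathematicalPhysics.PowerSystems.LyapunovFunctionFamilyRegionOfAttraction
import HarnessLib

/-!
# Vu–Turitsyn's finite-region circle criterion: quadratic Lyapunov certificates for the bilinear
# power-system model (Lemma 1 of the TAC 2017 framework)

Topic `Literature/MathematicalPhysics/PowerSystems`, namespace
`Literature.MathematicalPhysics.PowerSystems.LyapunovFunctionFamily` (the `System` structure
`ẋ = Ax − BF(Cx)`, `F_k = sin(δ*_k + (Cx)_k) − sin δ*_k`, is reused; the STRUCTURE-PRESERVING model
with first-order load buses is such a system with `A = [[0, I, 0], [0, −M₁⁻¹D₁, 0], [0, 0, 0]]`,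
`B = [0; S₁M⁻¹EᵀS; S₂M⁻¹EᵀS]`, `C = E[I 0; 0 0 I]` — no `CB = 0` is needed here). Everything is
PROVED; the definitions are the certificate data and its Lyapunov function / decay rate.

SOURCE (read on the page). T. L. Vu, K. Turitsyn, «A Framework for Robust Assessment of Power Grid
Stability and Resiliency», IEEE TAC 62 (2017) [VuTuritsyn2017] (arXiv:1504.04684 chunks p0008,
p0009, p0016): §4.2 Lemma 1 «Consider the general system in the form (ẋ = Ax − BF(Cx)) in which the
nonlinear vector F satisfies the sector bound condition that (F − K₁Cx)ᵀ(F − K₂Cx) ≤ 0 for some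
matrices K₁, K₂ and x belonging to the set 𝒮. Assume that there exists a positive definite matrix P
such that AᵀP + PA − CᵀK₁ᵀK₂C + RᵀR ≤ 0, where R = BᵀP − ½(K₁ + K₂)C. Then, the quadratic
Lyapunov function V(x(t)) = x(t)ᵀPx(t) is decreasing along trajectory of the system whenever x(t)
is in the set 𝒮.»; Appendix 7.1 (its proof): «V̇(x) − W(x) = xᵀ[AᵀP + PA − CᵀK₁ᵀK₂C + RᵀR]x − SᵀS,
S = F + (BᵀP − ½(K₁+K₂)C)x … V̇(x) = W(x) − xᵀQx − SᵀS ≤ 0 ∀ x ∈ 𝒮»; §4.1 eq. (bound)/Lemma 2: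
for grids `K₁ = gI`, `K₂ = I`.

WHAT IS PROVED (scalar gains `K₁ = g·I`, `K₂ = I`, the case the paper uses):
* `QuadraticCertificate S` — DATA `(P, g, ε)` with `Pᵀ = P`, `P − ε·1 ⪰ 0`, `ε > 0`, and the
  matrix inequality `−(AᵀP + PA − g·CᵀC + RᵀR) ⪰ 0`, `R = BᵀP − ((1+g)/2)·C` — exactly Lemma 1's
  hypothesis (a certified exact fact for a kernel checker; note `RᵀR` is computed from `P`).
* `QuadraticCertificate.V x = xᵀPx`, `sectorForm x = (F − g·Cx)ᵀ(F − Cx)` (`W` of the proof),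
  `vdot x = 2xᵀP(Ax − BF)`; `contDiff_V`, `fderiv_V_field`: `vdot` IS `dV(x)(ẋ)`.
* `vdot_eq` — **the identity of Appendix 7.1**:
  `V̇(x) = W(x) + xᵀ(AᵀP + PA − gCᵀC + RᵀR)x − |F + Rx|²`.
* `vdot_le` / `vdot_nonpos_of_sector` — **Lemma 1**: `V̇(x) ≤ W(x) − |F + Rx|²`, hence `V̇(x) ≤ 0`
  wherever the sector condition `W(x) ≤ 0` holds.
* `le_V` — `ε|x|² ≤ V(x)` (coercivity from `P − ε1 ⪰ 0`).
* `sectorGain δ* = (1 − sin|δ*|)/(π/2 − |δ*|)`, `sectorGain_le_cos`, `sectorGain_mul_le`,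
  `sectorGain_mul_le_sin_sub` (the lower sector bound), `sector_line` — **§4.1 eq. (bound)/(sector)
  line by line**: for `|δ*| < π/2`, `g ≤ g⋆(δ*)` and `|δ* + y| ≤ π/2`,
  `(sin(δ* + y) − sin δ* − g·y)(sin(δ* + y) − sin δ* − y) ≤ 0`; hence
  `QuadraticCertificate.vdot_nonpos_of_mem_polytope`: `V̇ ≤ 0` on
  `𝒫 = {x : |δ*_k + (Cx)_k| ≤ π/2}` whenever `g ≤ g⋆(δ*_k)` for every line (Lemma 2's content for
  any system of the form (3)/(SP)).

* `System.halfPolytope` (`𝒫° = {|δ*_k + (Cx)_k| < π/2}`, open; frontier ⇒ a tight face),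
  `QuadraticCertificate.sq_dotProduct_le_of_posSemidef` / `lt_V_of_mem_frontier_halfPolytope` (the
  certified level `c < min_k (π/2 − |δ*_k|)²/s_k` from rank-one facts `s_k·P − C_kᵀC_k ⪰ 0`),
  `isCompact_well`, `mulVec_eq_zero_of_vdot_eq_zero` (`V̇ = 0 ⇒ Cx = 0` for STRICT gains
  `g < g⋆(δ*_k)`), `eq_zero_of_noDissipation`, and
  `QuadraticCertificate.well_subset_regionOfAttraction(_of_rankOne)` — **THEOREM 1, kernel form**:
  with the observability condition `Cx = 0 ∧ CAx = 0 ⇒ x = 0`, every state `y ∈ 𝒫°` with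
  `V(y) ≤ c` has a global solution and EVERY global solution from it stays in `{𝒫°, V ≤ c}` and
  tends to `0`.
* `System.mulVec_pow_eq_zero_of_output_eq_zero`, `System.observable_of_twoStep/threeStep`,
  `QuadraticCertificate.eq_zero_of_noDissipation_of_observable`,
  `well_subset_regionOfAttraction(_of_rankOne)_of_observable` — **THEOREM 1 under observability of
  the pair `(C, A)`** (`(∀ k, C Aᵏ x = 0) ⇒ x = 0`), the hypothesis that the machine-angle-reference
  state space WITH transfer conductances and NON-uniform damping [Pai1981, §3.6.3 (3.45), §4.7.3
  (4.114)–(4.117)] satisfies (three steps), where the two-step form fails.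

THREE COLUMNS. CERTIFIED: the statements below (kernel objects about the ODE class
`ẋ = Ax − BF(Cx)`); they turn an exact `(P, g, ε)` passing the matrix inequality, rank-one level
facts and per-line gain inequalities `g < g⋆(δ*_k)` into an a-priori region-of-attraction statement.
MODELLED (outside): for structure-preserving models in ABSOLUTE angles the observability condition
fails along the uniform rotation — write the model relative to a reference bus (or quotient the
rotation) before instantiating; the uniform gain `g = (1 − sin γ)/(π/2 − γ)` of the paper satisfies
`g ≤ g⋆(δ*_k)` for `|δ*_k| ≤ γ` (checked per line by the instance; take it strict). Nothing here
says a device is stable.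
-/

noncomputable section

open Real Set Filter Matrix Finset
open scoped Topology

namespace Literature.MathematicalPhysics.PowerSystems.LyapunovFunctionFamily

variable {ι κ : Type*} [Fintype ι] [Fintype κ] [DecidableEq ι]

/-- **A quadratic (circle-criterion) certificate** for `ẋ = Ax − BF(Cx)` with scalar sector gains
`K₁ = g·I`, `K₂ = I`: a symmetric `P` with certified lower bound `P − ε·1 ⪰ 0`, `ε > 0`, and the
matrix inequality of Lemma 1, `AᵀP + PA − g·CᵀC + RᵀR ≤ 0` with `R = BᵀP − ((1+g)/2)·C`, stated
as positive-semidefiniteness of the negative. [cite: VuTuritsyn2017, §4.2 Lemma 1 (hypothesis, with K₁ = gI, K₂ = I as in Lemma 2)] -/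
structure QuadraticCertificate (S : System ι κ) where
  /-- the matrix of the quadratic Lyapunov function `V = xᵀPx` -/
  P : Matrix ι ι ℝ
  /-- the lower sector gain (`K₁ = g·I`; `K₂ = I`) -/
  g : ℝ
  /-- a certified lower bound `P ⪰ ε·1` -/
  ε : ℝ
  P_symm : Pᵀ = P
  ε_pos : 0 < ε
  P_ge : (P - ε • (1 : Matrix ι ι ℝ)).PosSemidef
  /-- Lemma 1's matrix inequality `AᵀP + PA − gCᵀC + RᵀR ≤ 0`, `R = BᵀP − ((1+g)/2)C` -/
  lmi : (-(S.Aᵀ * P + P * S.A - g • (S.Cᵀ * S.C)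
      + (S.Bᵀ * P - ((1 + g) / 2) • S.C)ᵀ * (S.Bᵀ * P - ((1 + g) / 2) • S.C))).PosSemidef

namespace QuadraticCertificate

variable {S : System ι κ} (Λ : QuadraticCertificate S)

/-- The matrix `R = BᵀP − ((1+g)/2)·C` of Lemma 1. [cite: VuTuritsyn2017, §4.2 Lemma 1] -/
def R : Matrix κ ι ℝ := S.Bᵀ * Λ.P - ((1 + Λ.g) / 2) • S.C

/-- The quadratic Lyapunov function `V(x) = xᵀPx`. [cite: VuTuritsyn2017, §4.2 Lemma 1] -/
def V (x : ι → ℝ) : ℝ := x ⬝ᵥ (Λ.P *ᵥ x)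

/-- The sector form `W(x) = (F − gCx)ᵀ(F − Cx)`, `F = F(Cx)` (non-positive exactly where the sector
bound `g(Cx)_k² ≤ (Cx)_k F_k ≤ (Cx)_k²` holds linewise). [cite: VuTuritsyn2017, Appendix 7.1 (definition of W)] -/
def sectorForm (x : ι → ℝ) : ℝ :=
  (S.nonlin x - Λ.g • (S.C *ᵥ x)) ⬝ᵥ (S.nonlin x - S.C *ᵥ x)

/-- `V̇(x) = ẋᵀPx + xᵀPẋ = 2xᵀP(Ax − BF)`. [cite: VuTuritsyn2017, Appendix 7.1 (first display)] -/
def vdot (x : ι → ℝ) : ℝ := 2 * (x ⬝ᵥ (Λ.P *ᵥ S.field x))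

/-! ### `vdot` is the derivative of `V` along the field -/

omit [DecidableEq ι] in
/-- Symmetry of the `P`-form: `uᵀPv = vᵀPu` (private plumbing). [folklore] -/
private theorem dotProduct_mulVec_comm {P : Matrix ι ι ℝ} (hP : Pᵀ = P) (u v : ι → ℝ) :
    u ⬝ᵥ (P *ᵥ v) = v ⬝ᵥ (P *ᵥ u) := by
  rw [Matrix.dotProduct_mulVec, ← Matrix.mulVec_transpose, hP, dotProduct_comm]

/-- Along the line `t ↦ x + t·v`: `V(x + tv) = V(x) + 2t·xᵀPv + t²·vᵀPv`, so the derivative at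
`t = 0` in the direction of the field is `vdot x` (private plumbing for `fderiv_V_field`).
[cite: VuTuritsyn2017, Appendix 7.1 (first display)] -/
private theorem hasDerivAt_V_comp_line (x : ι → ℝ) :
    HasDerivAt (fun t : ℝ => Λ.V (x + t • S.field x)) (Λ.vdot x) 0 := by
  set v := S.field x with hv
  have hfun : (fun t : ℝ => Λ.V (x + t • v))
      = fun t => Λ.V x + t * (2 * (x ⬝ᵥ (Λ.P *ᵥ v))) + t ^ 2 * (v ⬝ᵥ (Λ.P *ᵥ v)) := by
    funext t
    simp only [V, Matrix.mulVec_add, Matrix.mulVec_smul, dotProduct_add, add_dotProduct,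
      smul_dotProduct, dotProduct_smul, smul_eq_mul, dotProduct_mulVec_comm Λ.P_symm v x]
    ring
  rw [hfun, vdot]
  have h1 : HasDerivAt (fun t : ℝ => t * (2 * (x ⬝ᵥ (Λ.P *ᵥ v)))) (1 * (2 * (x ⬝ᵥ (Λ.P *ᵥ v)))) 0 :=
    (hasDerivAt_id (0 : ℝ)).mul_const _
  have h2 : HasDerivAt (fun t : ℝ => t ^ 2 * (v ⬝ᵥ (Λ.P *ᵥ v)))
      (((2 : ℕ) : ℝ) * (0 : ℝ) ^ (2 - 1) * (v ⬝ᵥ (Λ.P *ᵥ v))) 0 :=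
    (hasDerivAt_pow 2 (0 : ℝ)).mul_const _
  have h := (h1.const_add (Λ.V x)).fun_add h2
  rw [← hv]
  refine h.congr_deriv ?_
  norm_num

/-- `V` is twice continuously differentiable (a quadratic form; `Λ.contDiff_V.continuous`,
`Λ.contDiff_V.differentiable two_ne_zero` are its continuity and differentiability).
[cite: VuTuritsyn2017, §4.2 Lemma 1] -/
theorem contDiff_V : ContDiff ℝ 2 Λ.V := by
  have h : Λ.V = fun x => ∑ i, x i * ∑ j, Λ.P i j * x j := by
    funext x
    simp [V, Matrix.mulVec, dotProduct]
  rw [h]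
  fun_prop

/-- `dV(x)(Ax − BF(Cx)) = V̇(x) = 2xᵀP(Ax − BF(Cx))` in Fréchet form (the right-hand side is
`Λ.vdot x` by definition). [cite: VuTuritsyn2017, Appendix 7.1 (first display)] -/
theorem fderiv_V_field (x : ι → ℝ) :
    fderiv ℝ Λ.V x (S.field x) = 2 * (x ⬝ᵥ (Λ.P *ᵥ S.field x)) := by
  show fderiv ℝ Λ.V x (S.field x) = Λ.vdot x
  have hl : HasDerivAt (fun t : ℝ => x + t • S.field x) (S.field x) 0 := by
    simpa using ((hasDerivAt_id (0 : ℝ)).smul_const (S.field x)).const_add x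
  have hE : HasFDerivAt Λ.V (fderiv ℝ Λ.V x) x :=
    (Λ.contDiff_V.differentiable two_ne_zero x).hasFDerivAt
  have h1 : HasDerivAt (fun t : ℝ => Λ.V (x + t • S.field x)) (fderiv ℝ Λ.V x (S.field x)) 0 := by
    have h := hE.comp_hasDerivAt_of_eq (0 : ℝ) hl (by simp)
    simpa [Function.comp_def] using h
  exact h1.unique (Λ.hasDerivAt_V_comp_line x)

/-! ### Lemma 1: the decay identity and the circle-criterion bound -/

/-- **The identity of Appendix 7.1**: with `F = F(Cx)`, `R = BᵀP − ((1+g)/2)C`,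
`V̇(x) = W(x) + xᵀ(AᵀP + PA − g·CᵀC + RᵀR)x − |F + Rx|²`.
[cite: VuTuritsyn2017, Appendix 7.1 (eq. for V̇ − W)] -/
theorem vdot_eq (x : ι → ℝ) :
    Λ.vdot x = Λ.sectorForm x
      + x ⬝ᵥ ((S.Aᵀ * Λ.P + Λ.P * S.A - Λ.g • (S.Cᵀ * S.C) + Λ.Rᵀ * Λ.R) *ᵥ x)
      - (S.nonlin x + Λ.R *ᵥ x) ⬝ᵥ (S.nonlin x + Λ.R *ᵥ x) := by
  -- the transpose is the adjoint: `x ⬝ Mᵀu = Mx ⬝ u`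
  have adjι : ∀ (M : Matrix ι ι ℝ) (u : ι → ℝ), x ⬝ᵥ (Mᵀ *ᵥ u) = (M *ᵥ x) ⬝ᵥ u := by
    intro M u
    rw [Matrix.dotProduct_mulVec x Mᵀ, Matrix.vecMul_transpose]
  have adjκ : ∀ (M : Matrix κ ι ℝ) (u : κ → ℝ), x ⬝ᵥ (Mᵀ *ᵥ u) = (M *ᵥ x) ⬝ᵥ u := by
    intro M u
    rw [Matrix.dotProduct_mulVec x Mᵀ, Matrix.vecMul_transpose]
  -- atoms: a1 = xᵀP(Ax), pbf = xᵀP(BF), ff, fc, cc, rr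
  set F := S.nonlin x with hF
  set y := S.C *ᵥ x with hy
  have hRx : Λ.R *ᵥ x = S.Bᵀ *ᵥ (Λ.P *ᵥ x) - ((1 + Λ.g) / 2) • y := by
    simp only [R, Matrix.sub_mulVec, Matrix.smul_mulVec, Matrix.mulVec_mulVec, hy]
  have hFR : F ⬝ᵥ (Λ.R *ᵥ x)
      = x ⬝ᵥ (Λ.P *ᵥ (S.B *ᵥ F)) - (1 + Λ.g) / 2 * (F ⬝ᵥ y) := by
    rw [hRx, dotProduct_sub, dotProduct_smul, smul_eq_mul, Matrix.dotProduct_mulVec F S.Bᵀ,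
      Matrix.vecMul_transpose, ← dotProduct_mulVec_comm Λ.P_symm x (S.B *ᵥ F)]
  -- the four pieces
  have hv : Λ.vdot x = 2 * (x ⬝ᵥ (Λ.P *ᵥ (S.A *ᵥ x))) - 2 * (x ⬝ᵥ (Λ.P *ᵥ (S.B *ᵥ F))) := by
    simp only [vdot, System.field, Matrix.mulVec_sub, dotProduct_sub, hF]
    ring
  have hs : Λ.sectorForm x = F ⬝ᵥ F - (1 + Λ.g) * (F ⬝ᵥ y) + Λ.g * (y ⬝ᵥ y) := by
    simp only [sectorForm, ← hF, ← hy, sub_dotProduct, dotProduct_sub, smul_dotProduct,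
      smul_eq_mul, dotProduct_comm y F]
    ring
  have hm : x ⬝ᵥ ((S.Aᵀ * Λ.P + Λ.P * S.A - Λ.g • (S.Cᵀ * S.C) + Λ.Rᵀ * Λ.R) *ᵥ x)
      = 2 * (x ⬝ᵥ (Λ.P *ᵥ (S.A *ᵥ x))) - Λ.g * (y ⬝ᵥ y)
        + (Λ.R *ᵥ x) ⬝ᵥ (Λ.R *ᵥ x) := by
    rw [Matrix.add_mulVec, Matrix.sub_mulVec, Matrix.add_mulVec, Matrix.smul_mulVec,
      ← Matrix.mulVec_mulVec, ← Matrix.mulVec_mulVec, ← Matrix.mulVec_mulVec,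
      ← Matrix.mulVec_mulVec, dotProduct_add, dotProduct_sub, dotProduct_add, dotProduct_smul,
      smul_eq_mul, adjι S.A (Λ.P *ᵥ x), adjκ S.C (S.C *ᵥ x), adjκ Λ.R (Λ.R *ᵥ x),
      dotProduct_mulVec_comm Λ.P_symm (S.A *ᵥ x) x, ← hy]
    ring
  have hl : (F + Λ.R *ᵥ x) ⬝ᵥ (F + Λ.R *ᵥ x)
      = F ⬝ᵥ F + 2 * (F ⬝ᵥ (Λ.R *ᵥ x)) + (Λ.R *ᵥ x) ⬝ᵥ (Λ.R *ᵥ x) := by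
    rw [add_dotProduct, dotProduct_add, dotProduct_add, dotProduct_comm (Λ.R *ᵥ x) F]
    ring
  rw [hv, hs, hm, hl, hFR]
  ring

/-- **Lemma 1, quantitative form**: `V̇(x) ≤ W(x) − |F + Rx|²` (the LMI term is `≤ 0`).
[cite: VuTuritsyn2017, §4.2 Lemma 1 with Appendix 7.1 (last display)] -/
theorem vdot_le (x : ι → ℝ) :
    Λ.vdot x ≤ Λ.sectorForm x - (S.nonlin x + Λ.R *ᵥ x) ⬝ᵥ (S.nonlin x + Λ.R *ᵥ x) := by
  have hlmi := Λ.lmi.dotProduct_mulVec_nonneg x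
  rw [star_trivial, Matrix.neg_mulVec, dotProduct_neg] at hlmi
  have hR : Λ.R = S.Bᵀ * Λ.P - ((1 + Λ.g) / 2) • S.C := rfl
  rw [Λ.vdot_eq x, hR]
  linarith

/-- **Lemma 1 (Vu–Turitsyn's finite-region circle criterion)**: wherever the sector condition
`W(x) = (F − gCx)ᵀ(F − Cx) ≤ 0` holds, `V̇(x) ≤ 0` — the quadratic Lyapunov function `xᵀPx` is
non-increasing along every solution while it stays in the sector set.
[cite: VuTuritsyn2017, §4.2 Lemma 1] -/
theorem vdot_nonpos_of_sector {x : ι → ℝ} (hW : Λ.sectorForm x ≤ 0) : Λ.vdot x ≤ 0 := by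
  have h := Λ.vdot_le x
  have hsq : 0 ≤ (S.nonlin x + Λ.R *ᵥ x) ⬝ᵥ (S.nonlin x + Λ.R *ᵥ x) := by
    simp only [dotProduct]
    exact Finset.sum_nonneg fun i _ => mul_self_nonneg _
  linarith

/-- The sector form linewise: `W(x) = Σ_k (F_k − g(Cx)_k)(F_k − (Cx)_k)`; it is `≤ 0` as soon as
every line satisfies `(F_k − g·y_k)(F_k − y_k) ≤ 0`, `y = Cx` (i.e. `F_k` lies between `g·y_k`
and `y_k`). [cite: VuTuritsyn2017, §4.1 eq. (bound) ⇒ (sector)] -/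
theorem sectorForm_nonpos_of_linewise {x : ι → ℝ}
    (h : ∀ k, (S.nonlin x k - Λ.g * (S.C *ᵥ x) k) * (S.nonlin x k - (S.C *ᵥ x) k) ≤ 0) :
    Λ.sectorForm x ≤ 0 := by
  simp only [sectorForm, dotProduct, Pi.sub_apply, Pi.smul_apply, smul_eq_mul]
  exact Finset.sum_nonpos fun k _ => h k

/-- **Coercivity**: `ε·|x|² ≤ V(x)` from `P − ε·1 ⪰ 0`. [cite: VuTuritsyn2017, §4.2 Lemma 1 (P positive definite)] -/
theorem le_V (x : ι → ℝ) : Λ.ε * (x ⬝ᵥ x) ≤ Λ.V x := by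
  have h := Λ.P_ge.dotProduct_mulVec_nonneg x
  rw [star_trivial, Matrix.sub_mulVec, Matrix.smul_mulVec, Matrix.one_mulVec, dotProduct_sub,
    dotProduct_smul, smul_eq_mul] at h
  unfold V
  linarith

end QuadraticCertificate

/-! ### The sector bound for the sine nonlinearity on the polytope `|δ| ≤ π/2` (§4.1 eq. (bound))

For an equilibrium line angle `|δ*| < π/2` and every line angle `δ = δ* + y` with `|δ| ≤ π/2`, the
nonlinearity `F = sin δ − sin δ*` lies between `g⋆·y` and `y`, `g⋆ = (1 − sin|δ*|)/(π/2 − |δ*|)`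
(the secant slope from `δ*` to the nearer end of `[−π/2, π/2]`); hence `(F − g·y)(F − y) ≤ 0` for
every `g ≤ g⋆` — the sector condition of Lemma 2 / eq. (sector), line by line. The upper part is
`|sin δ − sin δ*| ≤ |δ − δ*|`; for the lower part, `ψ(y) = sin(δ* + y) − sin δ* − g⋆y` vanishes at
`0`, is `≥ 0` at `y = π/2 − δ*` (Jordan's inequality when `δ* < 0`), and `ψ' = cos(δ* + y) − g⋆`
is `≥ 0` as long as `cos(δ* + y) ≥ g⋆` (true at `y = 0`) and `< 0` afterwards, so `ψ ≥ 0`. -/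

/-- `cos s·(π/2 − s) ≥ 1 − sin s` for `0 ≤ s ≤ π/2` (the secant slope to the nearer endpoint does
not exceed the tangent slope; private plumbing: `u sin u ≥ (2/π)u² ≥ u²/2 ≥ 1 − cos u`). [folklore] -/
private theorem one_sub_sin_le_cos_mul {s : ℝ} (hs0 : 0 ≤ s) (hs : s ≤ π / 2) :
    1 - Real.sin s ≤ Real.cos s * (π / 2 - s) := by
  set u := π / 2 - s with hu
  have hu0 : 0 ≤ u := by linarith
  have huπ : u ≤ π / 2 := by linarith
  have hcs : Real.cos s = Real.sin u := by rw [hu, Real.sin_pi_div_two_sub]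
  have hss : Real.sin s = Real.cos u := by rw [hu, Real.cos_pi_div_two_sub]
  rw [hcs, hss]
  have h1 := Real.mul_le_sin hu0 huπ
  have h2 := Real.one_sub_sq_div_two_le_cos (x := u)
  have hπ : 2 / π * u * u ≥ u ^ 2 / 2 := by
    have : (1 : ℝ) / 2 ≤ 2 / π := by
      rw [div_le_div_iff₀ (by norm_num) Real.pi_pos]
      linarith [Real.pi_le_four]
    nlinarith
  nlinarith [mul_le_mul_of_nonneg_right h1 hu0]

/-- The lower sector gain of a line with equilibrium angle `δ*`:
`g⋆(δ*) = (1 − sin|δ*|)/(π/2 − |δ*|)`. [cite: VuTuritsyn2017, §4.1 eq. (gain)] -/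
def sectorGain (δs : ℝ) : ℝ := (1 - Real.sin |δs|) / (π / 2 - |δs|)

/-- `g⋆(δ*) ≤ cos δ*` for `|δ*| < π/2`. [cite: VuTuritsyn2017, §4.1 eq. (gain)–(bound)] -/
theorem sectorGain_le_cos {δs : ℝ} (hδs : |δs| < π / 2) : sectorGain δs ≤ Real.cos δs := by
  rw [sectorGain, div_le_iff₀ (by linarith), ← Real.cos_abs]
  exact one_sub_sin_le_cos_mul (abs_nonneg δs) hδs.le

/-- `g⋆(δ*)·(π/2 − δ*) ≤ 1 − sin δ*` for `|δ*| < π/2` (equality for `δ* ≥ 0`; Jordan's inequality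
`(2/π)s ≤ sin s` for `δ* = −s < 0`). [cite: VuTuritsyn2017, §4.1 eq. (gain) (the minimum of the two endpoint slopes)] -/
theorem sectorGain_mul_le {δs : ℝ} (hδs : |δs| < π / 2) :
    sectorGain δs * (π / 2 - δs) ≤ 1 - Real.sin δs := by
  rcases le_or_gt 0 δs with h | h
  · rw [sectorGain, abs_of_nonneg h, div_mul_cancel₀]
    rw [abs_of_nonneg h] at hδs
    linarith
  · have hs : |δs| = -δs := abs_of_neg h
    rw [hs] at hδs
    rw [sectorGain, hs, Real.sin_neg, div_mul_eq_mul_div, div_le_iff₀ (by linarith)]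
    have hj := Real.mul_le_sin (x := -δs) (by linarith) hδs.le
    rw [Real.sin_neg] at hj
    -- (1 + sin δs)(π/2 − δs) ≤ (1 − sin δs)(π/2 + δs) ⟸ π·(−sin δs) ≥ 2·(−δs)
    have hπ := Real.pi_pos
    have key : π * (2 / π * -δs) = 2 * -δs := by field_simp
    nlinarith [mul_le_mul_of_nonneg_left hj hπ.le, key]

/-- The derivative of `ψ(y) = sin(δ* + y) − sin δ* − g·y`. [cite: VuTuritsyn2017, §4.1 eq. (bound)] -/
private theorem hasDerivAt_psi (δs g y : ℝ) :
    HasDerivAt (fun y => Real.sin (δs + y) - Real.sin δs - g * y) (Real.cos (δs + y) - g) y := by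
  have h1 : HasDerivAt (fun y => Real.sin (δs + y)) (Real.cos (δs + y) * 1) y :=
    (Real.hasDerivAt_sin (δs + y)).comp y ((hasDerivAt_id y).const_add δs)
  have h2 : HasDerivAt (fun y : ℝ => g * y) (g * 1) y := (hasDerivAt_id y).const_mul g
  simpa using (h1.sub_const (Real.sin δs)).fun_sub h2

/-- **The lower sector bound, right side**: for `|δ*| < π/2` and `0 ≤ y ≤ π/2 − δ*`,
`sin(δ* + y) − sin δ* ≥ g⋆(δ*)·y`. [cite: VuTuritsyn2017, §4.1 eq. (bound) (lower inequality)] -/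
theorem sectorGain_mul_le_sin_sub {δs : ℝ} (hδs : |δs| < π / 2) {y : ℝ} (hy0 : 0 ≤ y)
    (hy : δs + y ≤ π / 2) : sectorGain δs * y ≤ Real.sin (δs + y) - Real.sin δs := by
  set g := sectorGain δs with hg
  set ψ : ℝ → ℝ := fun t => Real.sin (δs + t) - Real.sin δs - g * t with hψ
  have hδ1 : -(π / 2) < δs := by have := neg_abs_le δs; linarith
  have hδ2 : δs < π / 2 := by have := le_abs_self δs; linarith
  have hgc : g ≤ Real.cos δs := sectorGain_le_cos hδs
  have hψ0 : ψ 0 = 0 := by simp [hψ]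
  have hψL : 0 ≤ ψ (π / 2 - δs) := by
    have := sectorGain_mul_le (δs := δs) hδs
    simp only [hψ, add_sub_cancel, Real.sin_pi_div_two]
    linarith
  have hderiv : ∀ t, deriv ψ t = Real.cos (δs + t) - g := fun t => (hasDerivAt_psi δs g t).deriv
  have hdiff : ∀ D : Set ℝ, DifferentiableOn ℝ ψ D := fun D t _ =>
    (hasDerivAt_psi δs g t).differentiableAt.differentiableWithinAt
  have hcont : ∀ D : Set ℝ, ContinuousOn ψ D := fun D => (hdiff D).continuousOn
  -- `cos ≥ cos δ*` on `[δ*, 0]` and `cos ≥ cos b` on `[0, b]`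
  have hcos_ge : ∀ a b : ℝ, δs ≤ a → a ≤ b → b ≤ π / 2 →
      min (Real.cos δs) (Real.cos b) ≤ Real.cos a := by
    intro a b ha hab hb
    rcases le_or_gt a 0 with ha0 | ha0
    · have h : Real.cos δs ≤ Real.cos a := by
        rw [← Real.cos_abs δs, ← Real.cos_abs a]
        exact Real.cos_le_cos_of_nonneg_of_le_pi (abs_nonneg a)
          (by have := abs_lt.2 ⟨hδ1, hδ2⟩; linarith [Real.pi_pos])
          (by rw [abs_of_nonpos ha0]; have := neg_le_abs δs; linarith)
      exact (min_le_left _ _).trans h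
    · have h : Real.cos b ≤ Real.cos a :=
        Real.cos_le_cos_of_nonneg_of_le_pi ha0.le (by linarith [Real.pi_pos]) hab
      exact (min_le_right _ _).trans h
  suffices h : 0 ≤ ψ y by simpa [hψ] using h
  rcases le_or_gt g (Real.cos (δs + y)) with hA | hB
  · -- ψ is monotone on [0, y]
    have hmono : MonotoneOn ψ (Icc 0 y) := by
      refine monotoneOn_of_deriv_nonneg (convex_Icc 0 y) (hcont _) (hdiff _) fun t ht => ?_
      rw [hderiv]
      have ht' : t ∈ Icc 0 y := interior_subset ht
      have := hcos_ge (δs + t) (δs + y) (by linarith [ht'.1]) (by linarith [ht'.2]) hy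
      have hmin : g ≤ min (Real.cos δs) (Real.cos (δs + y)) := le_min hgc hA
      linarith
    have := hmono ⟨le_rfl, hy0⟩ ⟨hy0, le_rfl⟩ hy0
    rw [hψ0] at this
    exact this
  · -- δ* + y > 0 and ψ is antitone on [y, π/2 − δ*]
    have hpos : 0 < δs + y := by
      by_contra hneg
      rw [not_lt] at hneg
      have hle : Real.cos δs ≤ Real.cos (δs + y) := by
        rw [← Real.cos_abs δs, ← Real.cos_abs (δs + y)]
        exact Real.cos_le_cos_of_nonneg_of_le_pi (abs_nonneg _)
          (by have := abs_lt.2 ⟨hδ1, hδ2⟩; linarith [Real.pi_pos])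
          (by rw [abs_of_nonpos hneg]; have := neg_le_abs δs; linarith)
      linarith
    have hanti : AntitoneOn ψ (Icc y (π / 2 - δs)) := by
      refine antitoneOn_of_deriv_nonpos (convex_Icc _ _) (hcont _) (hdiff _) fun t ht => ?_
      rw [hderiv]
      have ht' : t ∈ Icc y (π / 2 - δs) := interior_subset ht
      have : Real.cos (δs + t) ≤ Real.cos (δs + y) :=
        Real.cos_le_cos_of_nonneg_of_le_pi hpos.le (by linarith [ht'.2, Real.pi_pos])
          (by linarith [ht'.1])
      linarith
    have hyL : y ≤ π / 2 - δs := by linarith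
    have := hanti ⟨le_rfl, hyL⟩ ⟨hyL, le_rfl⟩ hyL
    linarith

/-- **The sector condition, line by line** (eq. (bound) ⇒ eq. (sector)): for `|δ*| < π/2`, every
`g ≤ g⋆(δ*)` and every `y` with `|δ* + y| ≤ π/2`,
`(sin(δ* + y) − sin δ* − g·y)·(sin(δ* + y) − sin δ* − y) ≤ 0`.
[cite: VuTuritsyn2017, §4.1 eq. (bound) and eq. (sector)] -/
theorem sector_line {δs : ℝ} (hδs : |δs| < π / 2) {g : ℝ} (hg : g ≤ sectorGain δs) {y : ℝ}
    (hy : |δs + y| ≤ π / 2) :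
    (Real.sin (δs + y) - Real.sin δs - g * y) * (Real.sin (δs + y) - Real.sin δs - y) ≤ 0 := by
  have hδ1 : -(π / 2) < δs := by have := neg_abs_le δs; linarith
  have hδ2 : δs < π / 2 := by have := le_abs_self δs; linarith
  obtain ⟨hy1, hy2⟩ := abs_le.1 hy
  -- the Lipschitz (upper) part and the sign of F
  have hlip := Real.abs_sin_sub_sin_le (δs + y) δs
  rw [add_sub_cancel_left] at hlip
  rcases le_or_gt 0 y with hy0 | hy0
  · -- y ≥ 0: g y ≤ g⋆ y ≤ F ≤ y
    have hF : Real.sin (δs + y) - Real.sin δs ≤ y := by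
      have := le_abs_self (Real.sin (δs + y) - Real.sin δs)
      rw [abs_of_nonneg hy0] at hlip
      linarith
    have hlow := sectorGain_mul_le_sin_sub hδs hy0 hy2
    have hgy : g * y ≤ sectorGain δs * y := mul_le_mul_of_nonneg_right hg hy0
    nlinarith
  · -- y < 0: reflect: δ*' = −δ*, y' = −y
    have hδs' : |(-δs)| < π / 2 := by rwa [abs_neg]
    have hlow := sectorGain_mul_le_sin_sub hδs' (neg_nonneg.2 hy0.le) (by linarith)
    rw [show -δs + -y = -(δs + y) by ring, Real.sin_neg, Real.sin_neg, sectorGain, abs_neg] at hlow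
    have hg' : g ≤ sectorGain δs := hg
    rw [sectorGain] at hg'
    have hF : y ≤ Real.sin (δs + y) - Real.sin δs := by
      have := neg_abs_le (Real.sin (δs + y) - Real.sin δs)
      rw [abs_of_neg hy0] at hlip
      linarith
    have hgy : sectorGain δs * y ≤ g * y := mul_le_mul_of_nonpos_right hg hy0.le
    rw [sectorGain] at hgy
    nlinarith

namespace QuadraticCertificate

variable {S : System ι κ} (Λ : QuadraticCertificate S)

/-- **The sector condition on the polytope** `𝒫 = {x : |δ*_k + (Cx)_k| ≤ π/2 ∀k}`: if
`|δ*_k| < π/2` and the certificate's gain satisfies `g ≤ g⋆(δ*_k)` for every line, then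
`W(x) ≤ 0` on `𝒫`, so `V̇ ≤ 0` there (Lemma 2's use of Lemma 1). [cite: VuTuritsyn2017, §4.2 Lemma 2 (proof: eq. (bound) gives the sector bound on 𝒫)] -/
theorem vdot_nonpos_of_mem_polytope (hδs : ∀ k, |S.δs k| < π / 2)
    (hg : ∀ k, Λ.g ≤ sectorGain (S.δs k)) {x : ι → ℝ}
    (hx : ∀ k, |S.δs k + (S.C *ᵥ x) k| ≤ π / 2) : Λ.vdot x ≤ 0 :=
  Λ.vdot_nonpos_of_sector (Λ.sectorForm_nonpos_of_linewise fun k =>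
    sector_line (hδs k) (hg k) (hx k))

end QuadraticCertificate

/-! ### Theorem 1: the invariant region `ℛ = {x ∈ 𝒫 : V ≤ c}` and convergence

The architecture of `Certificate.well_subset_regionOfAttraction` (LFF file), with the OPEN polytope
`𝒫° = {x : |δ*_k + (Cx)_k| < π/2 ∀k}` (the printed `𝒫` uses `≤`; the well `{x ∈ 𝒫° : V ≤ c}` with
`c` below `V` on the faces is the same kind of set as the printed `ℛ = {x ∈ 𝒫 : V < V_min}`), a
certified level from rank-one facts `s_k·P − C_kᵀC_k ⪰ 0` (`V ≥ (Cx)_k²/s_k ≥ (π/2 − |δ*_k|)²/s_k`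
on the face of line `k`), and hypothesis (iii) of the Barbashin–Krasovskii package discharged from
`V̇ = 0 ⇒ W(x) = 0 ⇒ Cx = 0` (STRICT gain `g < g⋆(δ*_k)`) and the observability condition. -/

/-- Strict Lipschitz bound of the sine: `|sin a − sin b| < |a − b|` for `a ≠ b` (private
plumbing). [folklore] -/
private theorem abs_sin_sub_sin_lt {a b : ℝ} (hab : a ≠ b) :
    |Real.sin a - Real.sin b| < |a - b| := by
  rw [Real.sin_sub_sin, abs_mul, abs_mul, abs_two]
  have h1 : |Real.sin ((a - b) / 2)| < |(a - b) / 2| :=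
    Real.abs_sin_lt_abs (by intro h; apply hab; linarith)
  have h2 : |Real.cos ((a + b) / 2)| ≤ 1 := Real.abs_cos_le_one _
  have h3 : |(a - b) / 2| = |a - b| / 2 := by rw [abs_div, abs_two]
  nlinarith [abs_nonneg (Real.sin ((a - b) / 2)), abs_nonneg (Real.cos ((a + b) / 2)),
    abs_nonneg (a - b)]

/-- A zero of the line sector term in the open sector with STRICT gain is the equilibrium:
`|δ*| < π/2`, `g < g⋆(δ*)`, `|δ* + y| ≤ π/2`, `(F − g·y)(F − y) = 0` ⇒ `y = 0`.
[cite: VuTuritsyn2017, §4.1 eq. (bound) (strict inside the sector)] -/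
theorem eq_zero_of_sector_line_eq_zero {δs : ℝ} (hδs : |δs| < π / 2) {g : ℝ}
    (hg : g < sectorGain δs) {y : ℝ} (hy : |δs + y| ≤ π / 2)
    (h0 : (Real.sin (δs + y) - Real.sin δs - g * y) * (Real.sin (δs + y) - Real.sin δs - y) = 0) :
    y = 0 := by
  by_contra hy0
  rcases mul_eq_zero.1 h0 with h | h
  · -- F = g y contradicts the sector with the sharp gain g⋆
    have hs := sector_line hδs le_rfl hy
    have hF : Real.sin (δs + y) - Real.sin δs = g * y := by linarith
    rw [hF] at hs
    -- (g y − g⋆ y)(g y − y) ≤ 0 with y ≠ 0: (g − g⋆)(g − 1) y² ≤ 0, but g < g⋆ ≤ ... need g < 1 too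
    have hg1 : sectorGain δs ≤ 1 := by
      -- g⋆ ≤ cos δ* ≤ 1
      exact (sectorGain_le_cos hδs).trans (Real.cos_le_one δs)
    have hy2 : 0 < y ^ 2 := by positivity
    have : (g * y - sectorGain δs * y) * (g * y - y) = (g - sectorGain δs) * (g - 1) * y ^ 2 := by
      ring
    nlinarith [mul_pos_of_neg_of_neg (sub_neg.2 hg) (by linarith : g - 1 < 0)]
  · -- F = y contradicts the strict Lipschitz bound
    have hF : Real.sin (δs + y) - Real.sin δs = y := by linarith
    have hlt := abs_sin_sub_sin_lt (a := δs + y) (b := δs) (by intro h'; apply hy0; linarith)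
    rw [hF, add_sub_cancel_left] at hlt
    exact lt_irrefl _ hlt

namespace System

variable (S : System ι κ)

/-- The open sector polytope `𝒫° = {x : |δ*_k + (Cx)_k| < π/2 for every line k}` (line angles
strictly inside `(−π/2, π/2)`; the printed `𝒫` is its closure). [cite: VuTuritsyn2017, §4.1 (polytope 𝒫: |δ_kj| ≤ π/2)] -/
def halfPolytope : Set (ι → ℝ) := {x | ∀ k, |S.δs k + (S.C *ᵥ x) k| < π / 2}

omit [DecidableEq ι] in
/-- The open sector polytope is open. [cite: VuTuritsyn2017, §4.1] -/
theorem isOpen_halfPolytope : IsOpen S.halfPolytope := by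
  have heq : S.halfPolytope = ⋂ k, {x : ι → ℝ | |S.δs k + (S.C *ᵥ x) k| < π / 2} := by
    ext x
    simp [halfPolytope, Set.mem_iInter]
  rw [heq]
  refine isOpen_iInter_of_finite fun k => ?_
  have hc : Continuous fun x : ι → ℝ => |S.δs k + (S.C *ᵥ x) k| := by
    have : (fun x : ι → ℝ => |S.δs k + (S.C *ᵥ x) k|)
        = fun x => |S.δs k + ∑ j, S.C k j * x j| := by
      funext x
      simp [Matrix.mulVec, dotProduct]
    rw [this]
    fun_prop
  exact isOpen_lt hc continuous_const

omit [DecidableEq ι] in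
/-- On the frontier of the open sector polytope every line has `|δ_k| ≤ π/2` and some line is
tight, `|δ_k| = π/2`. [cite: VuTuritsyn2017, §4.3 (boundary segments ∂𝒫_kj)] -/
theorem exists_tight_of_mem_frontier_halfPolytope {x : ι → ℝ} (hx : x ∈ frontier S.halfPolytope) :
    (∀ k, |S.δs k + (S.C *ᵥ x) k| ≤ π / 2) ∧ ∃ k, |S.δs k + (S.C *ᵥ x) k| = π / 2 := by
  rw [frontier, S.isOpen_halfPolytope.interior_eq] at hx
  obtain ⟨hcl, hnot⟩ := hx
  have hclosed : IsClosed {x : ι → ℝ | ∀ k, |S.δs k + (S.C *ᵥ x) k| ≤ π / 2} := by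
    have heq : {x : ι → ℝ | ∀ k, |S.δs k + (S.C *ᵥ x) k| ≤ π / 2}
        = ⋂ k, {x : ι → ℝ | |S.δs k + (S.C *ᵥ x) k| ≤ π / 2} := by
      ext x
      simp [Set.mem_iInter]
    rw [heq]
    refine isClosed_iInter fun k => ?_
    have hc : Continuous fun x : ι → ℝ => |S.δs k + (S.C *ᵥ x) k| := by
      have : (fun x : ι → ℝ => |S.δs k + (S.C *ᵥ x) k|)
          = fun x => |S.δs k + ∑ j, S.C k j * x j| := by
        funext x
        simp [Matrix.mulVec, dotProduct]
      rw [this]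
      fun_prop
    exact isClosed_le hc continuous_const
  have hsub : S.halfPolytope ⊆ {x : ι → ℝ | ∀ k, |S.δs k + (S.C *ᵥ x) k| ≤ π / 2} :=
    fun y hy k => (hy k).le
  have hle : ∀ k, |S.δs k + (S.C *ᵥ x) k| ≤ π / 2 := closure_minimal hsub hclosed hcl
  refine ⟨hle, ?_⟩
  by_contra hcon
  apply hnot
  intro k
  exact lt_of_le_of_ne (hle k) fun h => hcon ⟨k, h⟩

end System

namespace QuadraticCertificate

variable {S : System ι κ} (Λ : QuadraticCertificate S)

/-- A certified Cauchy–Schwarz bound in the `P`-metric: `s·P − c cᵀ ⪰ 0 ⇒ (cᵀx)² ≤ s·xᵀPx`.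
[cite: VuTuritsyn2017, §4.3 (V_min over the flow-out boundary; a certified lower bound)] -/
theorem sq_dotProduct_le_of_posSemidef {s : ℝ} {c : ι → ℝ}
    (hPSD : (s • Λ.P - Matrix.vecMulVec c c).PosSemidef) (x : ι → ℝ) :
    (c ⬝ᵥ x) ^ 2 ≤ s * Λ.V x := by
  have h := hPSD.dotProduct_mulVec_nonneg x
  have hr : Matrix.vecMulVec c c *ᵥ x = fun i => c i * (c ⬝ᵥ x) := by
    funext i
    simp [Matrix.mulVec, dotProduct, Matrix.vecMulVec, Finset.mul_sum, mul_assoc]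
  have hq : x ⬝ᵥ (Matrix.vecMulVec c c *ᵥ x) = (c ⬝ᵥ x) ^ 2 := by
    rw [hr]
    have e : (x ⬝ᵥ fun i => c i * (c ⬝ᵥ x)) = (∑ i, x i * c i) * (c ⬝ᵥ x) := by
      simp only [dotProduct, Finset.sum_mul]
      refine Finset.sum_congr rfl fun i _ => ?_
      ring
    rw [e, sq]
    congr 1
    simp only [dotProduct]
    refine Finset.sum_congr rfl fun i _ => ?_
    ring
  rw [star_trivial, Matrix.sub_mulVec, Matrix.smul_mulVec, dotProduct_sub, dotProduct_smul,
    smul_eq_mul, hq] at h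
  unfold V
  linarith

/-- **The certified level**: with rank-one facts `s_k·P − C_kᵀC_k ⪰ 0`, `s_k > 0`, every
`c < min_k (π/2 − |δ*_k|)²/s_k` lies below `V` on the frontier of the open sector polytope (on the
face of line `k`, `|(Cx)_k| ≥ π/2 − |δ*_k|`). [cite: VuTuritsyn2017, §4.3 eq. (V_min) (a certified lower bound)] -/
theorem lt_V_of_mem_frontier_halfPolytope (hδs : ∀ k, |S.δs k| < π / 2) {s : κ → ℝ}
    (hs0 : ∀ k, 0 < s k)
    (hs : ∀ k, (s k • Λ.P - Matrix.vecMulVec (S.C k) (S.C k)).PosSemidef) {c : ℝ}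
    (hc : ∀ k, c < (π / 2 - |S.δs k|) ^ 2 / s k) {x : ι → ℝ}
    (hx : x ∈ frontier S.halfPolytope) : c < Λ.V x := by
  obtain ⟨-, k, hk⟩ := S.exists_tight_of_mem_frontier_halfPolytope hx
  have hCx : (S.C *ᵥ x) k = S.C k ⬝ᵥ x := rfl
  have hface : π / 2 - |S.δs k| ≤ |(S.C *ᵥ x) k| := by
    have h1 : |S.δs k + (S.C *ᵥ x) k| ≤ |S.δs k| + |(S.C *ᵥ x) k| := abs_add_le _ _
    linarith
  have hnn : 0 ≤ π / 2 - |S.δs k| := by linarith [hδs k]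
  have hsq : (π / 2 - |S.δs k|) ^ 2 ≤ (S.C k ⬝ᵥ x) ^ 2 := by
    rw [← hCx, ← sq_abs ((S.C *ᵥ x) k)]
    exact pow_le_pow_left₀ hnn hface 2
  have hcs := Λ.sq_dotProduct_le_of_posSemidef (hs k) x
  have := hc k
  rw [lt_div_iff₀ (hs0 k)] at this
  nlinarith [hs0 k]

end QuadraticCertificate

namespace QuadraticCertificate

variable {S : System ι κ} (Λ : QuadraticCertificate S)

/-- `|x_i| ≤ √(|c|/ε)` on `{V ≤ c}` (coercivity `ε|x|² ≤ V`; private plumbing). [folklore] -/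
private theorem abs_le_of_V_le {c : ℝ} {x : ι → ℝ} (hx : Λ.V x ≤ c) (i : ι) :
    |x i| ≤ Real.sqrt (|c| / Λ.ε) := by
  have hε := Λ.ε_pos
  have hxx : x ⬝ᵥ x = ∑ j, x j ^ 2 := by simp [dotProduct, sq]
  have hco := Λ.le_V x
  rw [hxx] at hco
  have hsingle : x i ^ 2 ≤ ∑ j, x j ^ 2 :=
    Finset.single_le_sum (f := fun j => x j ^ 2) (fun j _ => sq_nonneg (x j)) (Finset.mem_univ i)
  have hbound : x i ^ 2 ≤ |c| / Λ.ε := by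
    rw [le_div_iff₀ hε]
    have hc' : Λ.V x ≤ |c| := hx.trans (le_abs_self c)
    nlinarith
  exact Real.abs_le_sqrt hbound

/-- **The well does not reach the faces**: if `c < V` on the frontier of `𝒫°`, then
`{x ∈ 𝒫° : V ≤ c} = {x ∈ closure 𝒫° : V ≤ c}`. [cite: VuTuritsyn2017, §4.3 Theorem 1 (ℛ does not meet the flow-out boundary)] -/
theorem well_eq_closure {c : ℝ} (hfr : ∀ x ∈ frontier S.halfPolytope, c < Λ.V x) :
    {x | x ∈ S.halfPolytope ∧ Λ.V x ≤ c} = {x | x ∈ closure S.halfPolytope ∧ Λ.V x ≤ c} := by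
  ext x
  constructor
  · rintro ⟨h1, h2⟩
    exact ⟨subset_closure h1, h2⟩
  · rintro ⟨h1, h2⟩
    refine ⟨?_, h2⟩
    by_contra hx
    have hmem : x ∈ frontier S.halfPolytope := by
      rw [frontier, S.isOpen_halfPolytope.interior_eq]
      exact ⟨h1, hx⟩
    have := hfr x hmem
    linarith

/-- **Compactness of the well** `{x ∈ 𝒫° : V ≤ c}` when `c < V` on the faces (closed by
`well_eq_closure`, bounded by coercivity). [cite: VuTuritsyn2017, §4.3 Theorem 1 (set ℛ)] -/
theorem isCompact_well {c : ℝ} (hfr : ∀ x ∈ frontier S.halfPolytope, c < Λ.V x) :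
    IsCompact {x | x ∈ S.halfPolytope ∧ Λ.V x ≤ c} := by
  rw [Λ.well_eq_closure hfr]
  set R : ℝ := Real.sqrt (|c| / Λ.ε) with hR
  have hsub : {x | x ∈ closure S.halfPolytope ∧ Λ.V x ≤ c}
      ⊆ Set.pi Set.univ (fun _ : ι => Icc (-R) R) := by
    rintro x ⟨-, h2⟩ i -
    have habs : |x i| ≤ R := Λ.abs_le_of_V_le h2 i
    exact ⟨by linarith [neg_abs_le (x i)], by linarith [le_abs_self (x i)]⟩
  refine (isCompact_univ_pi fun _ => isCompact_Icc).of_isClosed_subset ?_ hsub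
  exact isClosed_closure.inter (isClosed_le Λ.contDiff_V.continuous continuous_const)

/-- **`V̇(x) = 0` in the sector polytope forces `Cx = 0`** (strict gain): by `vdot_le`,
`0 = V̇ ≤ W(x) − |F + Rx|² ≤ 0`, so `W(x) = 0`; `W` is a sum of non-positive line terms, so every
line term vanishes, so every `(Cx)_k = 0` (`eq_zero_of_sector_line_eq_zero`).
[cite: VuTuritsyn2017, Appendix 7.1 (V̇ = W − xᵀQx − SᵀS) with §4.1 eq. (bound)] -/
theorem mulVec_eq_zero_of_vdot_eq_zero (hδs : ∀ k, |S.δs k| < π / 2)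
    (hg : ∀ k, Λ.g < sectorGain (S.δs k)) {x : ι → ℝ}
    (hx : ∀ k, |S.δs k + (S.C *ᵥ x) k| ≤ π / 2) (hv : Λ.vdot x = 0) : S.C *ᵥ x = 0 := by
  have hle := Λ.vdot_le x
  have hsq : 0 ≤ (S.nonlin x + Λ.R *ᵥ x) ⬝ᵥ (S.nonlin x + Λ.R *ᵥ x) := by
    simp only [dotProduct]
    exact Finset.sum_nonneg fun i _ => mul_self_nonneg _
  have hterm : ∀ k, (S.nonlin x k - Λ.g * (S.C *ᵥ x) k) * (S.nonlin x k - (S.C *ᵥ x) k) ≤ 0 :=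
    fun k => sector_line (hδs k) (hg k).le (hx k)
  have hW : Λ.sectorForm x = ∑ k, (S.nonlin x k - Λ.g * (S.C *ᵥ x) k)
      * (S.nonlin x k - (S.C *ᵥ x) k) := by
    simp only [sectorForm, dotProduct, Pi.sub_apply, Pi.smul_apply, smul_eq_mul]
  have hWle : Λ.sectorForm x ≤ 0 := by
    rw [hW]
    exact Finset.sum_nonpos fun k _ => hterm k
  have hW0 : Λ.sectorForm x = 0 := by linarith
  rw [hW] at hW0
  have hk := (Finset.sum_eq_zero_iff_of_nonpos fun k _ => hterm k).1 hW0
  funext k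
  exact eq_zero_of_sector_line_eq_zero (hδs k) (hg k) (hx k) (hk k (Finset.mem_univ k))

/-- **Hypothesis (iii) of Barbashin–Krasovskii for Theorem 1.** Assume `|δ*_k| < π/2`, strict
gains `g < g⋆(δ*_k)`, the observability condition `Cx = 0 ∧ CAx = 0 ⇒ x = 0`, and `c < V` on the
faces. Then a global solution `Y` from the well with `V̇(Y t) = 0` for all `t ≥ 0` starts at `0`:
the well is positively invariant (a priori), so `C Y ≡ 0` on `[0, 1]`; differentiating,
`C Ẏ(0) = CAY(0) − CB F(0) = CAY(0) = 0`. [cite: VuTuritsyn2017, §4.3 Theorem 1 (convergence to the equilibrium)] -/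
theorem eq_zero_of_noDissipation (hδs : ∀ k, |S.δs k| < π / 2)
    (hg : ∀ k, Λ.g < sectorGain (S.δs k))
    (hobs : ∀ x : ι → ℝ, S.C *ᵥ x = 0 → S.C *ᵥ (S.A *ᵥ x) = 0 → x = 0)
    {c : ℝ} (hfr : ∀ x ∈ frontier S.halfPolytope, c < Λ.V x)
    {Y : ℝ → ι → ℝ} (hY0 : Y 0 ∈ S.halfPolytope) (hYc : Λ.V (Y 0) ≤ c)
    (hY : ∀ T : ℝ, ∀ t ∈ Icc 0 T, HasDerivWithinAt Y (S.field (Y t)) (Icc 0 T) t)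
    (hzero : ∀ t, 0 ≤ t → Λ.vdot (Y t) = 0) : Y 0 = 0 := by
  -- a priori invariance of the well on `[0, 1]`
  have hdiff := Λ.contDiff_V.differentiable two_ne_zero
  have hV' : ∀ x ∈ S.halfPolytope ∩ univ, HasFDerivAt Λ.V (fderiv ℝ Λ.V x) x := fun x _ =>
    (hdiff x).hasFDerivAt
  have hVF : ∀ x ∈ S.halfPolytope ∩ univ, fderiv ℝ Λ.V x (S.field x) ≤ 0 := by
    intro x hx
    rw [Λ.fderiv_V_field x]
    exact Λ.vdot_nonpos_of_mem_polytope hδs (fun k => (hg k).le) fun k => (hx.1 k).le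
  have hSeq : {x | x ∈ S.halfPolytope ∩ univ ∧ Λ.V x ≤ c}
      = {x | x ∈ S.halfPolytope ∧ Λ.V x ≤ c} := by
    ext x
    simp
  have hScl : IsClosed {x | x ∈ S.halfPolytope ∩ univ ∧ Λ.V x ≤ c} := by
    rw [hSeq]
    exact (Λ.isCompact_well hfr).isClosed
  have hstay := Literature.Analysis.ODE.mem_sublevel_of_solution (M := univ)
    S.isOpen_halfPolytope hV' hVF hScl (hY 1) (fun _ _ => mem_univ _) ⟨hY0, hYc⟩
  -- `C Y(t) = 0` on `[0, 1]`
  have hC0 : ∀ t ∈ Icc (0 : ℝ) 1, S.C *ᵥ Y t = 0 := fun t ht =>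
    Λ.mulVec_eq_zero_of_vdot_eq_zero hδs hg (fun k => ((hstay t ht).1 k).le) (hzero t ht.1)
  -- `F(C Y(0)) = 0`, so `C Ẏ(0) = C A Y(0)`
  have hF0 : S.nonlin (Y 0) = 0 := by
    funext k
    have := congrFun (hC0 0 ⟨le_rfl, zero_le_one⟩) k
    simp only [Pi.zero_apply] at this
    simp [System.nonlin, this]
  have hCA : S.C *ᵥ (S.A *ᵥ Y 0) = 0 := by
    have hCF : S.C *ᵥ S.field (Y 0) = S.C *ᵥ (S.A *ᵥ Y 0) := by
      simp only [System.field, hF0, Matrix.mulVec_zero, sub_zero]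
    rw [← hCF]
    funext k
    have hcomp : ∀ i, HasDerivWithinAt (fun t => Y t i) (S.field (Y 0) i) (Icc 0 1) 0 :=
      fun i => hasDerivWithinAt_pi.1 (hY 1 0 ⟨le_rfl, zero_le_one⟩) i
    have hd1 : HasDerivWithinAt (fun t => (S.C *ᵥ Y t) k) ((S.C *ᵥ S.field (Y 0)) k)
        (Icc 0 1) 0 := by
      have h := HasDerivWithinAt.fun_sum (u := Finset.univ)
        (A := fun i => fun t : ℝ => S.C k i * Y t i)
        (A' := fun i => S.C k i * S.field (Y 0) i) (x := (0 : ℝ)) (s := Icc 0 1)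
        (fun i _ => (hcomp i).const_mul (S.C k i))
      simpa [Matrix.mulVec, dotProduct] using h
    have hd0 : HasDerivWithinAt (fun t => (S.C *ᵥ Y t) k) 0 (Icc 0 1) 0 :=
      (hasDerivWithinAt_const (0 : ℝ) (Icc (0 : ℝ) 1) (0 : ℝ)).congr
        (fun t ht => by rw [hC0 t ht]; rfl) (by rw [hC0 0 ⟨le_rfl, zero_le_one⟩]; rfl)
    have hu : UniqueDiffWithinAt ℝ (Icc (0 : ℝ) 1) 0 :=
      uniqueDiffOn_Icc zero_lt_one 0 ⟨le_rfl, zero_le_one⟩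
    have := hu.eq_deriv _ hd1 hd0
    simpa using this
  exact hobs (Y 0) (hC0 0 ⟨le_rfl, zero_le_one⟩) hCA

/-- **Theorem 1 (Vu–Turitsyn's transient stability certificate from the quadratic Lyapunov
function), kernel form.** Let `S = (A, B, C, δ*)` be a system `ẋ = Ax − BF(Cx)` (network-reduced
or structure-preserving, written so that `Cx = 0 ∧ CAx = 0 ⇒ x = 0`), `|δ*_k| < π/2`, `Λ = (P, g,
ε)` a quadratic certificate (Lemma 1's matrix inequality, exact) with STRICT sector gains
`g < g⋆(δ*_k) = (1 − sin|δ*_k|)/(π/2 − |δ*_k|)`, and `c` a level with `c < V` on the faces of the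
sector polytope (e.g. `c < min_k (π/2 − |δ*_k|)²/s_k`, `lt_V_of_mem_frontier_halfPolytope`). Then
for every state `y` with all line angles in `(−π/2, π/2)` and `V(y) = yᵀPy ≤ c`: a global solution
from `y` exists, and EVERY global solution `X` from `y` keeps `|δ_k(t)| < π/2`, `V(X t) ≤ c` for all
`t ≥ 0` and tends to `0` — «from any initial state x₀ staying in set ℛ … the system trajectory will
only evolve in the set ℛ and eventually converge to the stable equilibrium point». CERTIFIED for the
MODEL `ẋ = Ax − BF(Cx)`, CLASS = the well; inner estimate; a priori over all solutions
(Barbashin–Krasovskii in place of LaSalle). [cite: VuTuritsyn2017, §4.3 Theorem 1; RoucheHabetsLaloy1977, Ch. II Thm 1.3] -/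
theorem well_subset_regionOfAttraction (hδs : ∀ k, |S.δs k| < π / 2)
    (hg : ∀ k, Λ.g < sectorGain (S.δs k))
    (hobs : ∀ x : ι → ℝ, S.C *ᵥ x = 0 → S.C *ᵥ (S.A *ᵥ x) = 0 → x = 0)
    {c : ℝ} (hfr : ∀ x ∈ frontier S.halfPolytope, c < Λ.V x)
    {y : ι → ℝ} (hy : y ∈ S.halfPolytope) (hyc : Λ.V y ≤ c) :
    (∃ X : ℝ → ι → ℝ, X 0 = y ∧
        ∀ T : ℝ, ∀ t ∈ Icc 0 T, HasDerivWithinAt X (S.field (X t)) (Icc 0 T) t) ∧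
      ∀ X : ℝ → ι → ℝ, X 0 = y →
        (∀ T : ℝ, ∀ t ∈ Icc 0 T, HasDerivWithinAt X (S.field (X t)) (Icc 0 T) t) →
        (∀ t, 0 ≤ t → X t ∈ S.halfPolytope ∧ Λ.V (X t) ≤ c) ∧ Tendsto X atTop (𝓝 0) := by
  have hdiff := Λ.contDiff_V.differentiable two_ne_zero
  set V' : (ι → ℝ) → ((ι → ℝ) →L[ℝ] ℝ) := fun x => fderiv ℝ Λ.V x with hV'def
  have hV : ∀ x ∈ S.halfPolytope ∩ univ, HasFDerivAt Λ.V (V' x) x := fun x _ =>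
    (hdiff x).hasFDerivAt
  have hVF : ∀ x ∈ S.halfPolytope ∩ univ, V' x (S.field x) ≤ 0 := by
    intro x hx
    show fderiv ℝ Λ.V x (S.field x) ≤ 0
    rw [Λ.fderiv_V_field x]
    exact Λ.vdot_nonpos_of_mem_polytope hδs (fun k => (hg k).le) fun k => (hx.1 k).le
  have hSeq : {x | x ∈ S.halfPolytope ∩ univ ∧ Λ.V x ≤ c}
      = {x | x ∈ S.halfPolytope ∧ Λ.V x ≤ c} := by
    ext x
    simp
  have hS : IsCompact {x | x ∈ S.halfPolytope ∩ univ ∧ Λ.V x ≤ c} := by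
    rw [hSeq]
    exact Λ.isCompact_well hfr
  have hMhyp : ∀ Y : ℝ → ι → ℝ, (Y 0 ∈ S.halfPolytope ∩ univ ∧ Λ.V (Y 0) ≤ c) →
      (∀ T : ℝ, ∀ t ∈ Icc 0 T, HasDerivWithinAt Y (S.field (Y t)) (Icc 0 T) t) →
      (∀ t, 0 ≤ t → V' (Y t) (S.field (Y t)) = 0) → Y 0 = 0 := by
    intro Y hY0 hY hzero
    refine Λ.eq_zero_of_noDissipation hδs hg hobs hfr hY0.1.1 hY0.2 hY fun t ht => ?_
    have h := hzero t ht
    have h' : fderiv ℝ Λ.V (Y t) (S.field (Y t)) = 0 := h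
    rw [Λ.fderiv_V_field (Y t)] at h'
    exact h'
  have hMinv : ∀ z, z ∈ S.halfPolytope ∩ univ ∧ Λ.V z ≤ c → ∀ s : ℝ, ∀ X : ℝ → ι → ℝ, X 0 = z →
      (∀ t ∈ Icc 0 s, HasDerivWithinAt X (S.field (X t)) (Icc 0 s) t) →
      ∀ t ∈ Icc 0 s, X t ∈ (univ : Set (ι → ℝ)) :=
    fun _ _ _ _ _ _ _ _ => mem_univ _
  have key := Literature.Analysis.ODE.sublevel_subset_regionOfAttraction_of_noCompleteTrajectory
    (E := ι → ℝ) (x₀ := 0) S.isOpen_halfPolytope hV hVF hS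
    ((Certificate.contDiff_field (S := S)).of_le (by norm_num)) hMhyp hMinv (y := y)
    ⟨⟨hy, mem_univ _⟩, hyc⟩
  refine ⟨key.1, fun X hX0 hX => ?_⟩
  obtain ⟨hstay, htend⟩ := key.2 X hX0 hX
  exact ⟨fun t ht => ⟨(hstay t ht).1.1, (hstay t ht).2⟩, htend⟩

/-- **Theorem 1 with the closed-form certified level**: under the hypotheses of
`well_subset_regionOfAttraction`, with rank-one facts `s_k·P − C_kᵀC_k ⪰ 0`, `s_k > 0`, every
`c < min_k (π/2 − |δ*_k|)²/s_k` is an admissible level. [cite: VuTuritsyn2017, §4.3 Theorem 1 with eq. (V_min)] -/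
theorem well_subset_regionOfAttraction_of_rankOne (hδs : ∀ k, |S.δs k| < π / 2)
    (hg : ∀ k, Λ.g < sectorGain (S.δs k))
    (hobs : ∀ x : ι → ℝ, S.C *ᵥ x = 0 → S.C *ᵥ (S.A *ᵥ x) = 0 → x = 0)
    {s : κ → ℝ} (hs0 : ∀ k, 0 < s k)
    (hs : ∀ k, (s k • Λ.P - Matrix.vecMulVec (S.C k) (S.C k)).PosSemidef)
    {c : ℝ} (hc : ∀ k, c < (π / 2 - |S.δs k|) ^ 2 / s k)
    {y : ι → ℝ} (hy : y ∈ S.halfPolytope) (hyc : Λ.V y ≤ c) :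
    (∃ X : ℝ → ι → ℝ, X 0 = y ∧
        ∀ T : ℝ, ∀ t ∈ Icc 0 T, HasDerivWithinAt X (S.field (X t)) (Icc 0 T) t) ∧
      ∀ X : ℝ → ι → ℝ, X 0 = y →
        (∀ T : ℝ, ∀ t ∈ Icc 0 T, HasDerivWithinAt X (S.field (X t)) (Icc 0 T) t) →
        (∀ t, 0 ≤ t → X t ∈ S.halfPolytope ∧ Λ.V (X t) ≤ c) ∧ Tendsto X atTop (𝓝 0) :=
  Λ.well_subset_regionOfAttraction hδs hg hobs
    (fun _ hx => Λ.lt_V_of_mem_frontier_halfPolytope hδs hs0 hs hc hx) hy hyc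

end QuadraticCertificate

/-! ### Theorem 1 under observability of the pair `(C, A)` — the state spaces with transfer
conductances and non-uniform damping

The convergence step of Theorem 1 needs, along a solution `X` with `V̇(X t) = 0` for all `t ≥ 0`,
that `X ≡ 0`.  Strict gains give `C X ≡ 0` (`mulVec_eq_zero_of_vdot_eq_zero`); then
`F(CX) = F(0) = 0`, so `X` solves the LINEAR system `ẋ = Ax` with output `Cx ≡ 0`, and the sharp
hypothesis is OBSERVABILITY of the pair `(C, A)`: `⋂ₖ ker(C Aᵏ) = 0` — the standing hypothesis
«(A, cᵀ) is observable» of the Lur'e problem [Pai1981, §2.15 (2.43)–(2.48), p. 46] and the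
minimal-realization discussion of the multimachine state spaces [Pai1981, §3.6.1–§3.6.2,
pp. 80–82: «for the non-uniform damping case … the minimal dimension of the state space is 2n−1;
for the uniform damping case … and zero damping case … 2n−2»].  The theorems
`well_subset_regionOfAttraction(_of_rankOne)` above take the TWO-STEP form
`Cx = 0 ∧ CAx = 0 ⇒ x = 0`, which holds for the second-order structures `[[0, I], [0, A_d]]`
(angles observed, one differentiation gives the speeds) but FAILS for the machine-angle-reference
state space of the model WITH transfer conductances and NON-uniform damping
[Pai1981, §3.6.3 (3.43)–(3.45): `x = (ω₁, …, ω_n | δ_in − δ_in^s)`, `A = [[−Λ, 0], [T, 0]]`]: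
there `Cx = 0 ∧ CAx = 0` leaves the uniform speed direction `ω = c·𝟙`, which only the THIRD
output derivative `CA²x = −ETΛω` removes (when the damping ratios `λ_i = D_i/M_i` are not all
equal).  Below: the same Theorem 1 with the hypothesis `(∀ k, C Aᵏ x = 0) ⇒ x = 0`, proved by
differentiating the output identity `C Aᵏ X ≡ 0` along the solution inside the invariant well
(`System.mulVec_pow_eq_zero_of_output_eq_zero`), plus the two- and three-step sufficient forms. -/

namespace System

variable (S : System ι κ)

omit [DecidableEq ι] in
/-- Derivative of a fixed linear image `t ↦ N·Y(t)` of a curve (componentwise sums; plumbing).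
[folklore] -/
private theorem hasDerivWithinAt_mulVec_comp {ρ : Type*} (N : Matrix ρ ι ℝ) {Y : ℝ → ι → ℝ}
    {Y' : ι → ℝ} {s : Set ℝ} {t : ℝ} (h : HasDerivWithinAt Y Y' s t) :
    HasDerivWithinAt (fun τ => N *ᵥ Y τ) (N *ᵥ Y') s t := by
  refine hasDerivWithinAt_pi.2 fun r => ?_
  have hcomp : ∀ i, HasDerivWithinAt (fun τ => Y τ i) (Y' i) s t :=
    fun i => hasDerivWithinAt_pi.1 h i
  have hsum := HasDerivWithinAt.fun_sum (u := Finset.univ)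
    (A := fun i => fun τ : ℝ => N r i * Y τ i) (A' := fun i => N r i * Y' i) (x := t) (s := s)
    (fun i _ => (hcomp i).const_mul (N r i))
  simpa [Matrix.mulVec, dotProduct] using hsum

/-- **Output nulling propagates through the powers of `A`.** If `Y` solves `ẋ = Ax − BF(Cx)` on
`[0, 1]` and `C Y(t) = 0` for all `t ∈ [0, 1]`, then `F(CY) ≡ 0`, `Y` solves the linear system
`ẋ = Ax` there, and `C Aᵏ Y(t) = 0` for every `k` and every `t ∈ [0, 1]` (induction on `k`:
the identity `C Aᵏ Y ≡ 0` on `[0, 1]` differentiates, within `[0, 1]`, to `C Aᵏ⁺¹ Y ≡ 0`).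
(The unobservable subspace of `(C, A)` is `⋂ₖ ker(C Aᵏ)`: the standing hypothesis «(A, cᵀ) is
observable» of the Lur'e problem and the minimal-realization test of the multimachine models.)
[cite: Pai1981, §2.15 hypothesis (ii) before (2.47), p. 46; §3.6.1–§3.6.2, pp. 80–82] -/
theorem mulVec_pow_eq_zero_of_output_eq_zero {Y : ℝ → ι → ℝ}
    (hY : ∀ t ∈ Icc (0 : ℝ) 1, HasDerivWithinAt Y (S.field (Y t)) (Icc 0 1) t)
    (hC0 : ∀ t ∈ Icc (0 : ℝ) 1, S.C *ᵥ Y t = 0) (k : ℕ) :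
    ∀ t ∈ Icc (0 : ℝ) 1, S.C *ᵥ (S.A ^ k *ᵥ Y t) = 0 := by
  -- the nonlinearity vanishes along `Y`, so the field is `A·Y`
  have hF0 : ∀ t ∈ Icc (0 : ℝ) 1, S.nonlin (Y t) = 0 := by
    intro t ht
    funext j
    have := congrFun (hC0 t ht) j
    simp only [Pi.zero_apply] at this
    simp [System.nonlin, this]
  have hlin : ∀ t ∈ Icc (0 : ℝ) 1, HasDerivWithinAt Y (S.A *ᵥ Y t) (Icc 0 1) t := by
    intro t ht
    have h := hY t ht
    simp only [System.field, hF0 t ht, Matrix.mulVec_zero, sub_zero] at h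
    exact h
  induction k with
  | zero =>
      intro t ht
      simpa using hC0 t ht
  | succ k ih =>
      intro t ht
      -- `t ↦ (C Aᵏ) Y t` vanishes on `[0,1]`; its derivative within `[0,1]` at `t` is `(C Aᵏ)(A Y t)`
      have hd1 : HasDerivWithinAt (fun τ => (S.C * S.A ^ k) *ᵥ Y τ)
          ((S.C * S.A ^ k) *ᵥ (S.A *ᵥ Y t)) (Icc 0 1) t :=
        hasDerivWithinAt_mulVec_comp (S.C * S.A ^ k) (hlin t ht)
      have hzero' : ∀ τ ∈ Icc (0 : ℝ) 1, (S.C * S.A ^ k) *ᵥ Y τ = 0 := by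
        intro τ hτ
        rw [← Matrix.mulVec_mulVec]
        exact ih τ hτ
      have hd0 : HasDerivWithinAt (fun τ => (S.C * S.A ^ k) *ᵥ Y τ) 0 (Icc 0 1) t :=
        (hasDerivWithinAt_const t (Icc (0 : ℝ) 1) (0 : κ → ℝ)).congr
          (fun τ hτ => hzero' τ hτ) (hzero' t ht)
      have hu : UniqueDiffWithinAt ℝ (Icc (0 : ℝ) 1) t := uniqueDiffOn_Icc zero_lt_one t ht
      have heq := hu.eq_deriv _ hd1 hd0
      -- `C Aᵏ⁺¹ Y t = (C Aᵏ)(A Y t) = 0`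
      rw [pow_succ, ← Matrix.mulVec_mulVec, Matrix.mulVec_mulVec]
      exact heq

/-- Two-step observability (the second-order structures: `Cx = 0 ∧ CAx = 0 ⇒ x = 0`) implies the
`(C, A)`-observability hypothesis (minimal order `2n − 2`: uniform / zero damping, or a bus).
[cite: Pai1981, §3.6.1 (ii), p. 81] -/
theorem observable_of_twoStep
    (h2 : ∀ x : ι → ℝ, S.C *ᵥ x = 0 → S.C *ᵥ (S.A *ᵥ x) = 0 → x = 0) (x : ι → ℝ)
    (hx : ∀ k : ℕ, S.C *ᵥ (S.A ^ k *ᵥ x) = 0) : x = 0 :=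
  h2 x (by simpa using hx 0) (by simpa using hx 1)

/-- Three-step observability (`Cx = 0 ∧ CAx = 0 ∧ CA²x = 0 ⇒ x = 0`, the machine-angle-reference
model with non-uniform damping, minimal order `2n − 1`) implies the `(C, A)`-observability
hypothesis. [cite: Pai1981, §3.6.1 (i), p. 81] -/
theorem observable_of_threeStep
    (h3 : ∀ x : ι → ℝ, S.C *ᵥ x = 0 → S.C *ᵥ (S.A *ᵥ x) = 0 →
      S.C *ᵥ (S.A *ᵥ (S.A *ᵥ x)) = 0 → x = 0) (x : ι → ℝ)
    (hx : ∀ k : ℕ, S.C *ᵥ (S.A ^ k *ᵥ x) = 0) : x = 0 := by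
  refine h3 x (by simpa using hx 0) (by simpa using hx 1) ?_
  have h := hx 2
  rwa [pow_two, ← Matrix.mulVec_mulVec] at h

end System

namespace QuadraticCertificate

variable {S : System ι κ} (Λ : QuadraticCertificate S)

/-- **Hypothesis (iii) of Barbashin–Krasovskii for Theorem 1, under observability of `(C, A)`.**
As `eq_zero_of_noDissipation`, with the two-step condition replaced by
`(∀ k, C Aᵏ x = 0) ⇒ x = 0`: a global solution `Y` from the well with `V̇(Y t) = 0` for all
`t ≥ 0` has `C Y ≡ 0` on `[0, 1]` (strict gains, a priori invariance of the well), hence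
`C Aᵏ Y(0) = 0` for every `k` (`System.mulVec_pow_eq_zero_of_output_eq_zero`), hence `Y 0 = 0`.
[cite: VuTuritsyn2017, §4.3 Theorem 1 (convergence step); Pai1981, §2.15 («(A, cᵀ) is observable»)] -/
theorem eq_zero_of_noDissipation_of_observable (hδs : ∀ k, |S.δs k| < π / 2)
    (hg : ∀ k, Λ.g < sectorGain (S.δs k))
    (hobs : ∀ x : ι → ℝ, (∀ k : ℕ, S.C *ᵥ (S.A ^ k *ᵥ x) = 0) → x = 0)
    {c : ℝ} (hfr : ∀ x ∈ frontier S.halfPolytope, c < Λ.V x)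
    {Y : ℝ → ι → ℝ} (hY0 : Y 0 ∈ S.halfPolytope) (hYc : Λ.V (Y 0) ≤ c)
    (hY : ∀ T : ℝ, ∀ t ∈ Icc 0 T, HasDerivWithinAt Y (S.field (Y t)) (Icc 0 T) t)
    (hzero : ∀ t, 0 ≤ t → Λ.vdot (Y t) = 0) : Y 0 = 0 := by
  -- a priori invariance of the well on `[0, 1]`
  have hdiff := Λ.contDiff_V.differentiable two_ne_zero
  have hV' : ∀ x ∈ S.halfPolytope ∩ univ, HasFDerivAt Λ.V (fderiv ℝ Λ.V x) x := fun x _ =>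
    (hdiff x).hasFDerivAt
  have hVF : ∀ x ∈ S.halfPolytope ∩ univ, fderiv ℝ Λ.V x (S.field x) ≤ 0 := by
    intro x hx
    rw [Λ.fderiv_V_field x]
    exact Λ.vdot_nonpos_of_mem_polytope hδs (fun k => (hg k).le) fun k => (hx.1 k).le
  have hSeq : {x | x ∈ S.halfPolytope ∩ univ ∧ Λ.V x ≤ c}
      = {x | x ∈ S.halfPolytope ∧ Λ.V x ≤ c} := by
    ext x
    simp
  have hScl : IsClosed {x | x ∈ S.halfPolytope ∩ univ ∧ Λ.V x ≤ c} := by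
    rw [hSeq]
    exact (Λ.isCompact_well hfr).isClosed
  have hstay := Literature.Analysis.ODE.mem_sublevel_of_solution (M := univ)
    S.isOpen_halfPolytope hV' hVF hScl (hY 1) (fun _ _ => mem_univ _) ⟨hY0, hYc⟩
  -- `C Y(t) = 0` on `[0, 1]`, hence `C Aᵏ Y(0) = 0` for every `k`
  have hC0 : ∀ t ∈ Icc (0 : ℝ) 1, S.C *ᵥ Y t = 0 := fun t ht =>
    Λ.mulVec_eq_zero_of_vdot_eq_zero hδs hg (fun k => ((hstay t ht).1 k).le) (hzero t ht.1)
  exact hobs (Y 0) fun k =>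
    S.mulVec_pow_eq_zero_of_output_eq_zero (hY 1) hC0 k 0 ⟨le_rfl, zero_le_one⟩

/-- **Theorem 1, kernel form, under observability of `(C, A)`.** As
`well_subset_regionOfAttraction`, with the two-step observability condition replaced by
`(∀ k, C Aᵏ x = 0) ⇒ x = 0` (any finite number of output derivatives; the machine-angle-reference
state space WITH transfer conductances and non-uniform damping is observable in three steps):
for `|δ*_k| < π/2`, strict gains `g < g⋆(δ*_k)`, `c < V` on the faces of the sector polytope,
every `y ∈ 𝒫°` with `V(y) ≤ c` has a global solution and EVERY global solution from `y` stays in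
`{𝒫°, V ≤ c}` and tends to `0`.  CERTIFIED for the MODEL `ẋ = Ax − BF(Cx)`, CLASS = the well;
inner estimate; a priori over all solutions.
[cite: VuTuritsyn2017, §4.3 Theorem 1; Pai1981, §3.6.3 (3.45) and §4.7.3 (4.114)–(4.117) (the Lur'e structure with transfer conductances); RoucheHabetsLaloy1977, Ch. II Thm 1.3] -/
theorem well_subset_regionOfAttraction_of_observable (hδs : ∀ k, |S.δs k| < π / 2)
    (hg : ∀ k, Λ.g < sectorGain (S.δs k))
    (hobs : ∀ x : ι → ℝ, (∀ k : ℕ, S.C *ᵥ (S.A ^ k *ᵥ x) = 0) → x = 0)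
    {c : ℝ} (hfr : ∀ x ∈ frontier S.halfPolytope, c < Λ.V x)
    {y : ι → ℝ} (hy : y ∈ S.halfPolytope) (hyc : Λ.V y ≤ c) :
    (∃ X : ℝ → ι → ℝ, X 0 = y ∧
        ∀ T : ℝ, ∀ t ∈ Icc 0 T, HasDerivWithinAt X (S.field (X t)) (Icc 0 T) t) ∧
      ∀ X : ℝ → ι → ℝ, X 0 = y →
        (∀ T : ℝ, ∀ t ∈ Icc 0 T, HasDerivWithinAt X (S.field (X t)) (Icc 0 T) t) →
        (∀ t, 0 ≤ t → X t ∈ S.halfPolytope ∧ Λ.V (X t) ≤ c) ∧ Tendsto X atTop (𝓝 0) := by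
  have hdiff := Λ.contDiff_V.differentiable two_ne_zero
  set V' : (ι → ℝ) → ((ι → ℝ) →L[ℝ] ℝ) := fun x => fderiv ℝ Λ.V x with hV'def
  have hV : ∀ x ∈ S.halfPolytope ∩ univ, HasFDerivAt Λ.V (V' x) x := fun x _ =>
    (hdiff x).hasFDerivAt
  have hVF : ∀ x ∈ S.halfPolytope ∩ univ, V' x (S.field x) ≤ 0 := by
    intro x hx
    show fderiv ℝ Λ.V x (S.field x) ≤ 0
    rw [Λ.fderiv_V_field x]
    exact Λ.vdot_nonpos_of_mem_polytope hδs (fun k => (hg k).le) fun k => (hx.1 k).le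
  have hSeq : {x | x ∈ S.halfPolytope ∩ univ ∧ Λ.V x ≤ c}
      = {x | x ∈ S.halfPolytope ∧ Λ.V x ≤ c} := by
    ext x
    simp
  have hS : IsCompact {x | x ∈ S.halfPolytope ∩ univ ∧ Λ.V x ≤ c} := by
    rw [hSeq]
    exact Λ.isCompact_well hfr
  have hMhyp : ∀ Y : ℝ → ι → ℝ, (Y 0 ∈ S.halfPolytope ∩ univ ∧ Λ.V (Y 0) ≤ c) →
      (∀ T : ℝ, ∀ t ∈ Icc 0 T, HasDerivWithinAt Y (S.field (Y t)) (Icc 0 T) t) →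
      (∀ t, 0 ≤ t → V' (Y t) (S.field (Y t)) = 0) → Y 0 = 0 := by
    intro Y hY0 hY hzero
    refine Λ.eq_zero_of_noDissipation_of_observable hδs hg hobs hfr hY0.1.1 hY0.2 hY
      fun t ht => ?_
    have h := hzero t ht
    have h' : fderiv ℝ Λ.V (Y t) (S.field (Y t)) = 0 := h
    rw [Λ.fderiv_V_field (Y t)] at h'
    exact h'
  have hMinv : ∀ z, z ∈ S.halfPolytope ∩ univ ∧ Λ.V z ≤ c → ∀ s : ℝ, ∀ X : ℝ → ι → ℝ, X 0 = z →
      (∀ t ∈ Icc 0 s, HasDerivWithinAt X (S.field (X t)) (Icc 0 s) t) →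
      ∀ t ∈ Icc 0 s, X t ∈ (univ : Set (ι → ℝ)) :=
    fun _ _ _ _ _ _ _ _ => mem_univ _
  have key := Literature.Analysis.ODE.sublevel_subset_regionOfAttraction_of_noCompleteTrajectory
    (E := ι → ℝ) (x₀ := 0) S.isOpen_halfPolytope hV hVF hS
    ((Certificate.contDiff_field (S := S)).of_le (by norm_num)) hMhyp hMinv (y := y)
    ⟨⟨hy, mem_univ _⟩, hyc⟩
  refine ⟨key.1, fun X hX0 hX => ?_⟩
  obtain ⟨hstay, htend⟩ := key.2 X hX0 hX
  exact ⟨fun t ht => ⟨(hstay t ht).1.1, (hstay t ht).2⟩, htend⟩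

/-- **Theorem 1 with the closed-form certified level, under observability of `(C, A)`**: with
rank-one facts `s_k·P − C_kᵀC_k ⪰ 0`, `s_k > 0`, every `c < min_k (π/2 − |δ*_k|)²/s_k` is an
admissible level. [cite: VuTuritsyn2017, §4.3 Theorem 1 with eq. (V_min); Pai1981, §2.15 and §3.6.1] -/
theorem well_subset_regionOfAttraction_of_rankOne_of_observable (hδs : ∀ k, |S.δs k| < π / 2)
    (hg : ∀ k, Λ.g < sectorGain (S.δs k))
    (hobs : ∀ x : ι → ℝ, (∀ k : ℕ, S.C *ᵥ (S.A ^ k *ᵥ x) = 0) → x = 0)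
    {s : κ → ℝ} (hs0 : ∀ k, 0 < s k)
    (hs : ∀ k, (s k • Λ.P - Matrix.vecMulVec (S.C k) (S.C k)).PosSemidef)
    {c : ℝ} (hc : ∀ k, c < (π / 2 - |S.δs k|) ^ 2 / s k)
    {y : ι → ℝ} (hy : y ∈ S.halfPolytope) (hyc : Λ.V y ≤ c) :
    (∃ X : ℝ → ι → ℝ, X 0 = y ∧
        ∀ T : ℝ, ∀ t ∈ Icc 0 T, HasDerivWithinAt X (S.field (X t)) (Icc 0 T) t) ∧
      ∀ X : ℝ → ι → ℝ, X 0 = y →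
        (∀ T : ℝ, ∀ t ∈ Icc 0 T, HasDerivWithinAt X (S.field (X t)) (Icc 0 T) t) →
        (∀ t, 0 ≤ t → X t ∈ S.halfPolytope ∧ Λ.V (X t) ≤ c) ∧ Tendsto X atTop (𝓝 0) :=
  Λ.well_subset_regionOfAttraction_of_observable hδs hg hobs
    (fun _ hx => Λ.lt_V_of_mem_frontier_halfPolytope hδs hs0 hs hc hx) hy hyc

end QuadraticCertificate

end Literature.MathematicalPhysics.PowerSystems.LyapunovFunctionFamily
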